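/-
Copyright: b2b-lace packet (enumeration shard B, gen 10).  The CLASS REGROUPING on top of the hyperoctahedral
class count (`LatticePointClasses`): the signed coordinate permutations of the tree (`Site.signedPerm`) act
TRANSITIVELY on every class `pointClass d r N`, every W_d-invariant function is constant on a class, the box
`{x : |x_μ| ≤ r}` is the disjoint union of the classes, and hence `Σ_{x ∈ box} g(x) = Σ_N |pointClass N| · g(rep N)`.
Pure combinatorics; no numerals, no dimension; nothing of the record is touched.
-/
import Mathlib.Data.Fin.Tuple.NatAntidiagonal
import Mathlib.Data.Fintype.EquivFin
import Literature.Probability.FitznerVanDerHofstad2017.LatticePointClasses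
import Literature.Barriers.CriticalPhenomena.LaceExpansionHighDimension
import HarnessLib

/-!
# Lattice point classes: transitivity of the hyperoctahedral group and the class regrouping of box sums

CITATION HEADER (PLACEMENT v2). This module is part of a certified REPRODUCTION of:
R. Fitzner, R. van der Hofstad, *Mean-field behavior for nearest-neighbor percolation in d > 10*,
Electron. J. Probab. 22 (2017), no. 43, 1–65 [FvdH17], and *Generalized approach to the non-backtracking
lace expansion*, Probab. Theory Related Fields 169 (2017), 1041–1119 [NoBLE17-I] (arXiv:1506.07977, 1506.07969).
Reproduces: the step "sum over all `x ∈ ℤ^d`" ↦ "sum over SYMMETRY CLASSES of end-points, each class weighted by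
its size `|O_d(v)|`" in the explicit computation of `(a_i ⊗ H_z)(0)` ([NoBLE17-I] §5.3.3), as the accompanying
notebooks and both engines of the build do it.  `LatticePointClasses` (node N67-W) supplies the classes
`pointClass d r N` and their cardinality; this module supplies the LICENCE for the regrouping: transitivity of the
signed coordinate permutations on a class, constancy of invariant functions on a class, the partition of the box by
classes, and the regrouped sum.  Origin: build `lace`, node N67-W⁺ (leaf feeding N67-S2/N67-S3, the class route of
the weighted-bubble cell) of `LEMMAS.md`.

## What is here

* `absCount_signedPerm` — the profile `absCount` is invariant under `Site.signedPerm π ε`;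
  `signedPerm_mem_pointClass_iff` — classes are `W_d`-stable;
* `exists_signedPerm_of_absCount_eq` — **transitivity**: two points with the same profile differ by a signed
  coordinate permutation (fibre bijections, `Equiv.ofFiberEquiv`); `absCount_eq_iff_exists_signedPerm`;
  `exists_signedPerm_of_mem_pointClass`;
* `SignedPermInvariant g` and `SignedPermInvariant.eq_of_mem_pointClass` / `.sum_pointClass_eq`
  (`Σ_{x ∈ class} g x = #class • g x₀`);
* `absBox d r` (the box `{x : ∀ μ, |x_μ| ≤ r}` as a `Finset`), `absCountVec`, `sum_absCount_eq_of_mem_absBox`,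
  `absBox_eq_biUnion` + `pairwiseDisjoint_pointClass` (the box is the disjoint union of the classes over the
  profiles `N ∈ antidiagonalTuple (r+1) d`), **`sum_absBox_eq_sum_pointClass`** and the representative form
  **`SignedPermInvariant.sum_absBox_eq`** (`Σ_{x ∈ box} g x = Σ_N #pointClass d r N • g (rep N)`),
  `tsum_eq_sum_absBox` (a lattice sum supported in the box is the box sum);
* the weight on a class: `sum_natAbs_sq_of_mem_pointClass` (`Σ_μ |x_μ|² = Σ_j N_j j²`) and
  `euclidNorm_sq_of_mem_pointClass` (the tree's `euclidNorm`, `‖x‖₂² = Σ_j N_j j²`),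
  `signedPermInvariant_euclidNorm_sq` (the norm itself is `W_d`-invariant in the tree already:
  `SpreadOutIsing.euclidNorm_signedPerm`, `euclidNorm_zdSignedPermIso` — not restated here).

## What is NOT here

No self-avoiding-walk counts, no numerals, no link to `Stage1CellsRec.V` (separate module).  No cited fact, no
named hypothesis, no `sorry`.

## References
* [NoBLE17-I] R. Fitzner, R. van der Hofstad, Generalized approach to the non-backtracking lace expansion,
  Probab. Theory Relat. Fields 169 (2017) 1041–1119; arXiv:1506.07969 — §5.3.3.
-/

namespace Literature.Probability.FitznerVanDerHofstad2017

open Finset Literature.Probability.LatticeModels Literature.Barriers.CriticalPhenomena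

variable {d r : ℕ}

/-! ### Invariance of the profile under signed coordinate permutations -/

/-- `|(σx)_μ| = |x_{π⁻¹ μ}|` for the signed coordinate permutation `σ = Site.signedPerm π ε`. [folklore] -/
@[simp] theorem natAbs_signedPerm_apply (π : Equiv.Perm (Fin d)) (ε : Fin d → ℤˣ) (x : Site d) (μ : Fin d) :
    (Site.signedPerm π ε x μ).natAbs = (x (π.symm μ)).natAbs := by
  rw [Site.signedPerm_apply, Int.natAbs_mul, Int.units_natAbs, one_mul]

/-- **The profile is `W_d`-invariant**: `absCount (σx) j = absCount x j`. [folklore] -/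
theorem absCount_signedPerm (π : Equiv.Perm (Fin d)) (ε : Fin d → ℤˣ) (x : Site d) (j : ℕ) :
    absCount (Site.signedPerm π ε x) j = absCount x j := by
  unfold absCount
  rw [← card_map (s := univ.filter fun μ : Fin d => (x μ).natAbs = j) π.toEmbedding]
  congr 1
  ext μ
  simp only [mem_filter, mem_univ, true_and, mem_map_equiv, natAbs_signedPerm_apply]

/-- **Classes are `W_d`-stable**: `σx ∈ pointClass d r N ↔ x ∈ pointClass d r N`. [folklore] -/
theorem signedPerm_mem_pointClass_iff {N : Fin (r + 1) → ℕ} (π : Equiv.Perm (Fin d)) (ε : Fin d → ℤˣ)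
    {x : Site d} : Site.signedPerm π ε x ∈ pointClass d r N ↔ x ∈ pointClass d r N := by
  simp only [mem_pointClass, absCount_signedPerm, natAbs_signedPerm_apply]
  refine and_congr_left fun _ => ⟨fun h μ => ?_, fun h μ => h _⟩
  simpa using h (π μ)

/-! ### Transitivity -/

/-- **Transitivity of the hyperoctahedral group on a profile**: if `x, y ∈ ℤ^d` have the same number of
coordinates of every absolute value, then `y = σ x` for a signed coordinate permutation `σ = Site.signedPerm π ε`
(permute by a bijection of the fibres of `|x_·|` and `|y_·|`, then fix the signs). [folklore] -/
theorem exists_signedPerm_of_absCount_eq {x y : Site d} (h : ∀ j, absCount x j = absCount y j) :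
    ∃ (π : Equiv.Perm (Fin d)) (ε : Fin d → ℤˣ), y = Site.signedPerm π ε x := by
  classical
  let f : Fin d → ℕ := fun μ => (x μ).natAbs
  let g : Fin d → ℕ := fun μ => (y μ).natAbs
  have hcard : ∀ j, Fintype.card {μ // f μ = j} = Fintype.card {μ // g μ = j} := by
    intro j
    rw [Fintype.card_subtype, Fintype.card_subtype]
    exact h j
  let e : ∀ j, {μ // f μ = j} ≃ {μ // g μ = j} := fun j => Fintype.equivOfCardEq (hcard j)
  let σ : Fin d ≃ Fin d := Equiv.ofFiberEquiv e
  have hσ : ∀ μ, g (σ μ) = f μ := Equiv.ofFiberEquiv_map e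
  refine ⟨σ, fun μ => if y μ = x (σ.symm μ) then 1 else -1, funext fun μ => ?_⟩
  have habs : (y μ).natAbs = (x (σ.symm μ)).natAbs := by
    have := hσ (σ.symm μ)
    rwa [Equiv.apply_symm_apply] at this
  rw [Site.signedPerm_apply]
  split_ifs with hμ
  · rw [Units.val_one, one_mul]; exact hμ
  · rcases Int.natAbs_eq_natAbs_iff.1 habs with h1 | h1
    · exact absurd h1 hμ
    · rw [Units.val_neg, Units.val_one, neg_one_mul]; exact h1

/-- The profile classifies the `W_d`-orbits of `ℤ^d`: equal profiles iff related by a signed coordinate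
permutation. [folklore] -/
theorem absCount_eq_iff_exists_signedPerm {x y : Site d} :
    (∀ j, absCount x j = absCount y j) ↔
      ∃ (π : Equiv.Perm (Fin d)) (ε : Fin d → ℤˣ), y = Site.signedPerm π ε x := by
  refine ⟨exists_signedPerm_of_absCount_eq, ?_⟩
  rintro ⟨π, ε, rfl⟩ j
  exact (absCount_signedPerm π ε x j).symm

/-- Beyond the top level `r` of a point of the box the profile vanishes. [folklore] -/
theorem absCount_eq_zero_of_lt {x : Site d} (hx : ∀ μ, (x μ).natAbs ≤ r) {j : ℕ} (hj : r < j) :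
    absCount x j = 0 := by
  unfold absCount
  rw [card_eq_zero, filter_eq_empty_iff]
  intro μ _ hμ
  have := hx μ
  omega

/-- Two points of the same class have the same profile at every level. [folklore] -/
theorem absCount_eq_of_mem_pointClass {N : Fin (r + 1) → ℕ} {x y : Site d} (hx : x ∈ pointClass d r N)
    (hy : y ∈ pointClass d r N) (j : ℕ) : absCount x j = absCount y j := by
  obtain ⟨hxr, hxN⟩ := mem_pointClass.1 hx
  obtain ⟨hyr, hyN⟩ := mem_pointClass.1 hy
  by_cases hj : j ≤ r
  · have h1 := hxN ⟨j, Nat.lt_succ_of_le hj⟩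
    have h2 := hyN ⟨j, Nat.lt_succ_of_le hj⟩
    exact h1.trans h2.symm
  · rw [absCount_eq_zero_of_lt hxr (not_le.1 hj), absCount_eq_zero_of_lt hyr (not_le.1 hj)]

/-- **Transitivity on a class**: two points of `pointClass d r N` differ by a signed coordinate permutation.
[folklore] -/
theorem exists_signedPerm_of_mem_pointClass {N : Fin (r + 1) → ℕ} {x y : Site d} (hx : x ∈ pointClass d r N)
    (hy : y ∈ pointClass d r N) : ∃ (π : Equiv.Perm (Fin d)) (ε : Fin d → ℤˣ), y = Site.signedPerm π ε x :=
  exists_signedPerm_of_absCount_eq (absCount_eq_of_mem_pointClass hx hy)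

/-! ### Invariant functions are constant on classes -/

/-- A function on `ℤ^d` invariant under the hyperoctahedral group `W_d` (signed coordinate permutations).
[folklore] -/
def SignedPermInvariant {β : Sort*} (g : Site d → β) : Prop :=
  ∀ (π : Equiv.Perm (Fin d)) (ε : Fin d → ℤˣ) (x : Site d), g (Site.signedPerm π ε x) = g x

/-- An invariant function is constant on every class. [folklore] -/
theorem SignedPermInvariant.eq_of_mem_pointClass {β : Sort*} {g : Site d → β} (hg : SignedPermInvariant g)
    {N : Fin (r + 1) → ℕ} {x y : Site d} (hx : x ∈ pointClass d r N) (hy : y ∈ pointClass d r N) :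
    g x = g y := by
  obtain ⟨π, ε, rfl⟩ := exists_signedPerm_of_mem_pointClass hx hy
  exact (hg π ε x).symm

/-- **Class sum of an invariant function**: `Σ_{x ∈ pointClass} g x = #pointClass • g x₀` for any `x₀` in the
class. [folklore] -/
theorem SignedPermInvariant.sum_pointClass_eq {β : Type*} [AddCommMonoid β] {g : Site d → β}
    (hg : SignedPermInvariant g) {N : Fin (r + 1) → ℕ} {x₀ : Site d} (hx₀ : x₀ ∈ pointClass d r N) :
    ∑ x ∈ pointClass d r N, g x = (pointClass d r N).card • g x₀ := by
  rw [sum_congr rfl fun x hx => hg.eq_of_mem_pointClass hx hx₀, sum_const]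

/-- Products of invariant functions are invariant. [folklore] -/
theorem SignedPermInvariant.mul {β : Type*} [Mul β] {g h : Site d → β} (hg : SignedPermInvariant g)
    (hh : SignedPermInvariant h) : SignedPermInvariant (fun x => g x * h x) :=
  fun π ε x => by simp only [hg π ε x, hh π ε x]

/-- Post-composition preserves invariance. [folklore] -/
theorem SignedPermInvariant.comp {β γ : Sort*} {g : Site d → β} (hg : SignedPermInvariant g) (φ : β → γ) :
    SignedPermInvariant (fun x => φ (g x)) :=
  fun π ε x => by show φ _ = φ _; rw [hg π ε x]

/-! ### The box and its partition by classes -/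

/-- The box `{x ∈ ℤ^d : |x_μ| ≤ r for all μ}` as a finite set. [folklore] -/
noncomputable def absBox (d r : ℕ) : Finset (Site d) := Fintype.piFinset fun _ => Icc (-(r : ℤ)) r

/-- Membership in the box. [folklore] -/
theorem mem_absBox {x : Site d} : x ∈ absBox d r ↔ ∀ μ, (x μ).natAbs ≤ r := by
  simp only [absBox, Fintype.mem_piFinset, mem_Icc]
  refine forall_congr' fun μ => ?_
  omega

/-- The box is `W_d`-stable. [folklore] -/
theorem signedPerm_mem_absBox_iff (π : Equiv.Perm (Fin d)) (ε : Fin d → ℤˣ) {x : Site d} :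
    Site.signedPerm π ε x ∈ absBox d r ↔ x ∈ absBox d r := by
  simp only [mem_absBox, natAbs_signedPerm_apply]
  exact ⟨fun h μ => by simpa using h (π μ), fun h μ => h _⟩

/-- Every class lies in the box. [folklore] -/
theorem pointClass_subset_absBox (N : Fin (r + 1) → ℕ) : pointClass d r N ⊆ absBox d r :=
  fun _ hx => mem_absBox.2 (mem_pointClass.1 hx).1

/-- The profile vector `(absCount x 0, …, absCount x r)` of a point. [folklore] -/
def absCountVec (r : ℕ) (x : Site d) : Fin (r + 1) → ℕ := fun j => absCount x j

/-- The levels `0, …, r` exhaust the `d` coordinates of a point of the box: `Σ_{j ≤ r} absCount x j = d`.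
[folklore] -/
theorem sum_absCount_eq_of_mem_absBox {x : Site d} (hx : x ∈ absBox d r) :
    ∑ j : Fin (r + 1), absCount x j = d := by
  have hr := mem_absBox.1 hx
  let f : Fin d → Fin (r + 1) := fun μ => ⟨(x μ).natAbs, Nat.lt_succ_of_le (hr μ)⟩
  have h := card_eq_sum_card_fiberwise (s := (univ : Finset (Fin d))) (t := (univ : Finset (Fin (r + 1))))
    (f := f) (fun _ _ => mem_univ _)
  rw [card_univ, Fintype.card_fin] at h
  refine Eq.trans (sum_congr rfl fun j _ => ?_) h.symm
  unfold absCount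
  congr 1
  ext μ
  simp only [mem_filter, mem_univ, true_and, f, Fin.ext_iff]

/-- A point of the box lies in the class of its own profile vector. [folklore] -/
theorem mem_pointClass_absCountVec {x : Site d} (hx : x ∈ absBox d r) : x ∈ pointClass d r (absCountVec r x) :=
  mem_pointClass.2 ⟨mem_absBox.1 hx, fun _ => rfl⟩

/-- The profile vector of a point of the box sums to `d`. [folklore] -/
theorem absCountVec_mem_antidiagonalTuple {x : Site d} (hx : x ∈ absBox d r) :
    absCountVec r x ∈ Finset.Nat.antidiagonalTuple (r + 1) d :=
  Finset.Nat.mem_antidiagonalTuple.2 (sum_absCount_eq_of_mem_absBox hx)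

/-- **The box is the union of the classes** over the profiles `N` with `Σ_j N_j = d`. [folklore] -/
theorem absBox_eq_biUnion (d r : ℕ) :
    absBox d r = (Finset.Nat.antidiagonalTuple (r + 1) d).biUnion (pointClass d r) := by
  ext x
  simp only [mem_biUnion]
  constructor
  · intro hx
    exact ⟨_, absCountVec_mem_antidiagonalTuple hx, mem_pointClass_absCountVec hx⟩
  · rintro ⟨N, -, hN⟩
    exact pointClass_subset_absBox N hN

/-- **Distinct profiles give disjoint classes.** [folklore] -/
theorem pairwiseDisjoint_pointClass (d r : ℕ) (S : Set (Fin (r + 1) → ℕ)) :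
    S.PairwiseDisjoint (pointClass d r) := by
  intro N _ N' _ hne
  refine disjoint_left.2 fun x hx hx' => hne ?_
  funext j
  rw [← (mem_pointClass.1 hx).2 j, (mem_pointClass.1 hx').2 j]

/-- **Class regrouping of a box sum**: `Σ_{x ∈ box} F x = Σ_N Σ_{x ∈ pointClass d r N} F x`.
[cite: FitznerVanDerHofstad2016NoBLE, §5.3.3 (the sum over all x ∈ ℤ^d regrouped by symmetry)] -/
theorem sum_absBox_eq_sum_pointClass {β : Type*} [AddCommMonoid β] (F : Site d → β) :
    ∑ x ∈ absBox d r, F x =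
      ∑ N ∈ Finset.Nat.antidiagonalTuple (r + 1) d, ∑ x ∈ pointClass d r N, F x := by
  rw [absBox_eq_biUnion, sum_biUnion (pairwiseDisjoint_pointClass d r _)]

/-- **Class regrouping with orbit sizes**: for a `W_d`-invariant `g` and any choice `rep N` of a point in every
non-empty class, `Σ_{x ∈ box} g x = Σ_N #pointClass d r N • g (rep N)`.
[cite: FitznerVanDerHofstad2016NoBLE, §5.3.3 (the sum over all x ∈ ℤ^d regrouped by symmetry)] -/
theorem SignedPermInvariant.sum_absBox_eq {β : Type*} [AddCommMonoid β] {g : Site d → β}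
    (hg : SignedPermInvariant g) (rep : (Fin (r + 1) → ℕ) → Site d)
    (hrep : ∀ N ∈ Finset.Nat.antidiagonalTuple (r + 1) d, (pointClass d r N).Nonempty →
      rep N ∈ pointClass d r N) :
    ∑ x ∈ absBox d r, g x =
      ∑ N ∈ Finset.Nat.antidiagonalTuple (r + 1) d, (pointClass d r N).card • g (rep N) := by
  rw [sum_absBox_eq_sum_pointClass]
  refine sum_congr rfl fun N hN => ?_
  rcases (pointClass d r N).eq_empty_or_nonempty with h0 | hne
  · simp [h0]
  · exact hg.sum_pointClass_eq (hrep N hN hne)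

/-- A lattice sum supported in the box is the box sum. [folklore] -/
theorem tsum_eq_sum_absBox {β : Type*} [AddCommMonoid β] [TopologicalSpace β] (F : Site d → β)
    (hF : ∀ x, x ∉ absBox d r → F x = 0) : ∑' x, F x = ∑ x ∈ absBox d r, F x :=
  tsum_eq_sum hF

/-- A lattice sum supported in the box, regrouped by classes. [folklore] -/
theorem tsum_eq_sum_pointClass {β : Type*} [AddCommMonoid β] [TopologicalSpace β] (F : Site d → β)
    (hF : ∀ x, x ∉ absBox d r → F x = 0) :
    ∑' x, F x = ∑ N ∈ Finset.Nat.antidiagonalTuple (r + 1) d, ∑ x ∈ pointClass d r N, F x := by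
  rw [tsum_eq_sum_absBox F hF, sum_absBox_eq_sum_pointClass]

/-! ### The weight `‖x‖₂²` on a class -/

/-- `Σ_μ |x_μ|² = Σ_{j ≤ r} N_j · j²` on the class of profile `N`. [folklore] -/
theorem sum_natAbs_sq_of_mem_pointClass {N : Fin (r + 1) → ℕ} {x : Site d} (hx : x ∈ pointClass d r N) :
    ∑ μ, (x μ).natAbs ^ 2 = ∑ j : Fin (r + 1), N j * (j : ℕ) ^ 2 := by
  obtain ⟨hr, hN⟩ := mem_pointClass.1 hx
  let f : Fin d → Fin (r + 1) := fun μ => ⟨(x μ).natAbs, Nat.lt_succ_of_le (hr μ)⟩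
  rw [← sum_fiberwise_of_maps_to (s := (univ : Finset (Fin d))) (t := (univ : Finset (Fin (r + 1))))
    (g := f) (fun _ _ => mem_univ _) (fun μ => (x μ).natAbs ^ 2)]
  refine sum_congr rfl fun j _ => ?_
  have hfib : ∀ μ ∈ univ.filter (fun μ => f μ = j), (x μ).natAbs ^ 2 = (j : ℕ) ^ 2 := by
    intro μ hμ
    have h := (mem_filter.1 hμ).2
    rw [← h]
  rw [sum_congr rfl hfib, sum_const, smul_eq_mul, ← hN j]
  unfold absCount
  congr 2
  ext μ
  simp only [mem_filter, mem_univ, true_and, f, Fin.ext_iff]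

/-- The tree's Euclidean norm squared is the natural-number sum `Σ_μ |x_μ|²`. [folklore] -/
theorem euclidNorm_sq_eq_natCast (x : Site d) : euclidNorm x ^ 2 = ((∑ μ, (x μ).natAbs ^ 2 : ℕ) : ℝ) := by
  unfold euclidNorm
  rw [Real.sq_sqrt (sum_nonneg fun _ _ => sq_nonneg _), Nat.cast_sum]
  refine sum_congr rfl fun μ _ => ?_
  rw [Nat.cast_pow, ← Int.cast_natCast, Int.natCast_natAbs, Int.cast_abs, sq_abs]

/-- **`‖x‖₂² = Σ_{j ≤ r} N_j · j²` on the class of profile `N`** (the weight of `H_z(x) = ‖x‖₂² G_z(x)` is constant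
on a class). [cite: FitznerVanDerHofstad2016NoBLE, §5.3.3 (H_z)] -/
theorem euclidNorm_sq_of_mem_pointClass {N : Fin (r + 1) → ℕ} {x : Site d} (hx : x ∈ pointClass d r N) :
    euclidNorm x ^ 2 = ((∑ j : Fin (r + 1), N j * (j : ℕ) ^ 2 : ℕ) : ℝ) := by
  rw [euclidNorm_sq_eq_natCast, sum_natAbs_sq_of_mem_pointClass hx]

/-- `Σ_μ |(σx)_μ|² = Σ_μ |x_μ|²`. [folklore] -/
theorem sum_natAbs_sq_signedPerm (π : Equiv.Perm (Fin d)) (ε : Fin d → ℤˣ) (x : Site d) :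
    ∑ μ, (Site.signedPerm π ε x μ).natAbs ^ 2 = ∑ μ, (x μ).natAbs ^ 2 := by
  simp only [natAbs_signedPerm_apply]
  exact Equiv.sum_comp π.symm (fun ν => (x ν).natAbs ^ 2)

/-- `x ↦ ‖x‖₂²` is a `W_d`-invariant weight (for the norm itself see the tree's
`SpreadOutIsing.euclidNorm_signedPerm` / `euclidNorm_zdSignedPermIso`). [folklore] -/
theorem signedPermInvariant_euclidNorm_sq : SignedPermInvariant (fun x : Site d => euclidNorm x ^ 2) :=
  fun π ε x => by
    show euclidNorm (Site.signedPerm π ε x) ^ 2 = euclidNorm x ^ 2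
    rw [euclidNorm_sq_eq_natCast, euclidNorm_sq_eq_natCast, sum_natAbs_sq_signedPerm]

end Literature.Probability.FitznerVanDerHofstad2017
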